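import Summits.BirchSwinnertonDyer.BirchSwinnertonDyer.Theorems.CMKolyvaginAtInertTwoCMKolyvaginConjectureAtInertTwoSelmerTriggerAnatomyOnGivenFrame
import Summits.BirchSwinnertonDyer.BirchSwinnertonDyer.Theorems.GenusKolyvaginAtTwoGenusPrimitiveSupplyAtTwoPosDiscShallowKFourPosConjTrivialSelmerModMW
import HarnessLib

/-!
# Route `CMKolyvaginAtInertTwo`, crux `CMKolyvaginConjectureAtInertTwo` (stmt-BirchSwinnertonDyer-24648),
# stub `stub_positiveDepth` — THE TWIN-`Ш` LAW FOR THE SELMER TRIGGER (census item (β) made necessary in the kernel):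
# if `Ш(E^{(d_K)}/ℚ)[2^∞] = 0` then every `w(E)`-signed class of `Sel_{2^M}(E/K)` (`w(E) = −1`) is `4`-torsion and twice it
# is a Kummer class — so the prime-level road of the first descent at `2` is CLOSED at every depth `M₀ ≥ 2`, and at depth
# one the trigger of hand 9's F3 §4 is a Selmer square root of a non-zero Kummer class

Seat `leafhand-bsd-cmkolyvaginatinert-10` g0 (cell `bsd-eis`); helper `--supports stmt-BirchSwinnertonDyer-24648`.
THEOREMS ONLY: no definition, no named fact introduced, no `sorry`; no stub, crux or summit closed; BSD is proved
for no curve.  File 2 of this seat (file 1: `…SelmerTriggerAnatomyOnGivenFrame`, the anatomy §1–§5).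

WHAT.  The censuses of hands 5–9 record the research residue (β) of `stub_positiveDepth` as «a SOURCE of
`s ∈ Sel_{2^M}(E/K)^{w(E)}` with `2·s ≠ 0` (depth one; file 1 §1: `2^{M₀}·s ≠ 0` at depth `M₀`) — a `#Ш^{w}[4] ≠ 1`-type
input = BSD₂ of the CM twin».  The sister route `GenusKolyvaginAtTwo` (crux K₄⁺, seat gk2-p4/LEAD gk2-p1) proved the
Kramer-type law `GenusExact.PlusDescent.torsionH1ToH1_conjAct_eq_of_mem_selmerGroup`: **if `Ш(E^{(d_K)}/ℚ)[2^∞] = 0` then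
complex conjugation acts TRIVIALLY on the image of `Sel_{2^k}(E/K)` in `Ш(E/K)`** (and `σ·m − m` is a Kummer class).  Fed into
file 1's anatomy this gives, for the twin `T = W.quadraticTwist d_K` and `w(E) = −1` (the habitat H₂ has `r_an = 1`;
displayed as the binder `hw`, = `(−1)^{r_an}` under the tree's fact `even_analyticRank_iff_rootNumber_eq_one`):

* §1 `two_zsmul_torsionH1ToH1_eq_zero_of_selmer_eigen_of_twinShaTrivial` — `Ш(T/ℚ)[2^∞] = 0`, `s ∈ Sel_{2^M}(E/K)`,
  `σ_* s = w(E)·s = −s` ⟹ **`2·š = 0`** in `Ш(E/K)` (`š = σ_* š = −š`).  No `ε`-line needed.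
* §2 `two_zsmul_mem_range_kummer_of_selmer_eigen_of_twinShaTrivial` — same inputs ⟹ **`2·s = δ(x)` is a Kummer class**
  (`σ_* s − s = −2·s`, gk2's `conjAct_sub_self_mem_range_kummerMapTorsion`).  No `ε`-line needed.
* §3 `four_zsmul_eq_zero_of_selmer_eigen_of_twinShaTrivial` — with `ρ̄_{E,2}` onto and the `ε`-line (`ε = −w(E) = +1`,
  binder `hline` as in hand 6 / file 1): **`4·s = 0`** (file 1 §3 at `k = 1` would give `2·š ≠ 0`).
* §4 `pow_zsmul_eq_zero_of_selmer_eigen_of_two_le_of_twinShaTrivial` — hence **`2^{M₀}·s = 0` for every `M₀ ≥ 2`**: the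
  trigger of file 1 §1 (`2^{M₀}·s ≠ 0`) DOES NOT EXIST at any depth `M₀ ≥ 2` when `Ш(E^{(d_K)}/ℚ)[2^∞] = 0` — the
  prime-level road of the first descent at `2` is closed there; only the composite-level iteration (census (γ)) or a
  frame with `Ш(E^{(d_K)}/ℚ)[2] ≠ 0` remains.
* §5 `selmerTrigger_shape_of_twinShaTrivial` — at depth one (F3 §4's trigger `2·s ≠ 0`): **`2·s = δ(x) ≠ 0` and `4·s = 0`**
  — on twin-`Ш`-trivial frames the only possible trigger is a `w(E)`-signed Selmer square root of the non-zero
  `2`-torsion Kummer class (file 1 §4's branch (B); branch (A) «`2·š ≠ 0`» is excluded by §1).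

REPAIR CENSUS after this file: (β) splits as (β₁) frames with `Ш(E^{(d_K)}/ℚ)[2] ≠ 0` — there a `w(E)`-signed `š` of
order `≥ 2^{M₀}` lifting to `Sel_{2^M}(E/K)` is what is needed (file 1 §3/§5; BSD₂ of the twin, research); (β₂) frames with
`Ш(E^{(d_K)}/ℚ)[2^∞] = 0` — depth `≥ 2`: NO prime-level trigger exists (§4, proved), so only (γ) the composite-level
iteration can serve; depth one: the trigger is exactly «`δ(x) ∈ 2·Sel_{2^M}(E/K)^{w}` for some `x ∈ E(K) ∖ 2^M E(K)`» (§5),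
a Kramer-class condition on the generator of `E(ℚ)` (inflation–restriction: `δ(x) = (1 − σ_*)s`), research but now a
statement about `Sel(E/K)` and `E(K)` only, with no `Ш` in it.  (γ), (δ) unchanged.
HONEST FRAMING.  Compositions of gk2-p4's twin-`Ш` law with file 1; the twin hypothesis `hT0`, `σ ≠ 1`, `w(E) = −1` and
(§3–§5) the `ε`-line are DISPLAYED binders; nothing here touches the research core of `stub_positiveDepth`; closes
nothing; BSD is proved for no curve.
References: [cite: Kramer1981, Thm. 1, Prop. 3] [cite: GrossLMS1991, §5 (5.1), Prop. 5.3] [cite: McCallumLMS1991, §5 Prop. 5.2, Thm. 5.4]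
[cite: SilvermanAEC2009, VIII.§2 (Kummer sequence), Thm. X.4.2 (a)]
presearch: «complex conjugation acts trivially on Sha(E/K) when the twist's Sha vanishes / Kramer» → tree: gk2-p4
`…PosTDefectOneBitLaw` + `…KFourPosConjTrivialSelmerModMW` (Kramer 1981 Thm. 1 [corpus: as cited there]); nothing at
`p = 2` for Kolyvagin's converse in print beyond hands 5–9's reading; composition only.
-/

set_option autoImplicit false
set_option linter.dupNamespace false -- the Theorems namespace repeats the summit name by design (D-0017)

noncomputable section
open scoped Classical
open Field NumberField IsDedekindDomain Function WeierstrassCurve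
open Literature.NumberTheory.EllipticCurves
open Literature.NumberTheory.EllipticCurves.ModularForms
open Literature.NumberTheory.GaloisRepresentations
open Literature.NumberTheory.GaloisCohomology
open Summit.BirchSwinnertonDyer.BirchSwinnertonDyer.Theorems.GenusExact.PlusDescent
  (torsionH1ToH1_conjAct_eq_of_mem_selmerGroup conjAct_sub_self_mem_range_kummerMapTorsion)

namespace Summit.BirchSwinnertonDyer.BirchSwinnertonDyer.Theorems.CMKolyvaginFirstDescentTwoOnGivenFrame

variable (W : WeierstrassCurve ℚ) [W.IsElliptic] {K : Type} [Field K] [NumberField K]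

/-! ## §1 `2·š = 0` for every `w(E)`-signed Selmer class, on twin-`Ш`-trivial frames -/

/-- **`Ш(E^{(d_K)}/ℚ)[2^∞] = 0 ⟹ 2·š = 0` for every `s ∈ Sel_{2^M}(E/K)` with `σ_* s = w(E)·s`, `w(E) = −1`.**  `E = W/ℚ`
elliptic, `K` imaginary quadratic, `σ ∈ Aut(K/ℚ)` non-trivial, the twist `T = W.quadraticTwist d_K` with `Ш(T/ℚ)[2^∞] = 0`
(binder `hT0`, gk2-p4's shape), `w(E) = −1` (binder `hw`).  gk2's law gives `σ_* š = š` in `Ш(E/K)`; the eigen-condition gives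
`σ_* š = w·š = −š`; so `2·š = 0`.  No `ε`-line is used.  [cite: Kramer1981, Thm. 1] [cite: GrossLMS1991, §5 (5.1)] -/
theorem two_zsmul_torsionH1ToH1_eq_zero_of_selmer_eigen_of_twinShaTrivial (hIQ : IsImaginaryQuadratic K)
    {σ : K ≃ₐ[ℚ] K} (hσ1 : σ ≠ 1)
    (hT0 : ∀ x ∈ AddCommGroup.primaryComponent (↥(W.quadraticTwist (NumberField.discr K : ℚ)).sha) 2, x = 0)
    (hw : W.rootNumber = -1) {M : ℕ} {s : galH1Torsion (W.baseChange K) ((2 ^ M : ℕ) : ℤ)}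
    (hs : s ∈ selmerGroup (W.baseChange K) ((2 ^ M : ℕ) : ℤ))
    (hsν : conjAct W σ ((2 ^ M : ℕ) : ℤ) s = W.rootNumber • s) :
    (2 : ℤ) • torsionH1ToH1 (W.baseChange K) ((2 ^ M : ℕ) : ℤ) s = 0 := by
  have h := torsionH1ToH1_conjAct_eq_of_mem_selmerGroup W K hIQ hσ1 hT0 M hs
  rw [hsν, map_zsmul, hw, neg_one_zsmul] at h
  -- `h : -š = š`
  rw [two_zsmul]
  nth_rw 1 [← h]
  exact neg_add_cancel _

/-! ## §2 `2·s` is a Kummer class, on twin-`Ш`-trivial frames -/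

/-- **`Ш(E^{(d_K)}/ℚ)[2^∞] = 0 ⟹ 2·s ∈ δ(E(K))` for every `s ∈ Sel_{2^M}(E/K)` with `σ_* s = w(E)·s`, `w(E) = −1`** (`hdiv` the
`2^M`-divisibility of `E(K̄)`, a binder only to name the Kummer map): gk2's `conjAct_sub_self_mem_range_kummerMapTorsion`
gives `σ_* s − s ∈ range δ`, and `σ_* s − s = −s − s = −(2·s)`.  No `ε`-line is used.
[cite: Kramer1981, Thm. 1] [cite: SilvermanAEC2009, VIII.§2 (Kummer sequence)] -/
theorem two_zsmul_mem_range_kummer_of_selmer_eigen_of_twinShaTrivial (hIQ : IsImaginaryQuadratic K)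
    {σ : K ≃ₐ[ℚ] K} (hσ1 : σ ≠ 1)
    (hT0 : ∀ x ∈ AddCommGroup.primaryComponent (↥(W.quadraticTwist (NumberField.discr K : ℚ)).sha) 2, x = 0)
    (hw : W.rootNumber = -1) {M : ℕ}
    (hdiv : ∀ P : geomPoints (W.baseChange K), ∃ Q : geomPoints (W.baseChange K), ((2 ^ M : ℕ) : ℤ) • Q = P)
    {s : galH1Torsion (W.baseChange K) ((2 ^ M : ℕ) : ℤ)}
    (hs : s ∈ selmerGroup (W.baseChange K) ((2 ^ M : ℕ) : ℤ))
    (hsν : conjAct W σ ((2 ^ M : ℕ) : ℤ) s = W.rootNumber • s) :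
    (2 : ℤ) • s ∈ (kummerMapTorsion (W.baseChange K) ((2 ^ M : ℕ) : ℤ) hdiv).range := by
  have h := conjAct_sub_self_mem_range_kummerMapTorsion W K hIQ hσ1 hT0 ⟨M, rfl⟩ hdiv hs
  rw [hsν, hw, neg_one_zsmul, ← neg_add', ← two_zsmul] at h
  -- `h : -(2 • s) ∈ range δ`
  exact (AddSubgroup.neg_mem_iff _).mp h

/-! ## §3 `4·s = 0`, on twin-`Ш`-trivial frames with the `ε`-line -/

/-- **`Ш(E^{(d_K)}/ℚ)[2^∞] = 0 ⟹ 4·s = 0` for every `s ∈ Sel_{2^M}(E/K)` with `σ_* s = w(E)·s`, `w(E) = −1`**, on `E/K` with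
`ρ̄_{E,2}` onto (so `E(K)[2] = 0`) and the `ε`-line `σ x − ε x ∈ E(K)_tors`, `ε = −w(E)` (binder `hline`, hand 6's shape): were
`4·s ≠ 0`, file 1 §3 (`sha_class_of_selmerTrigger` at `k = 1`) would give `2·š ≠ 0`, contradicting §1.
[cite: Kramer1981, Thm. 1] [cite: GrossLMS1991, §5 (5.1), Prop. 5.3] [cite: SilvermanAEC2009, VIII.§2, Thm. X.4.2 (a)] -/
theorem four_zsmul_eq_zero_of_selmer_eigen_of_twinShaTrivial (hρ2 : W.HasSurjectiveModNGaloisRep 2)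
    (hIQ : IsImaginaryQuadratic K) {σ : K ≃ₐ[ℚ] K} (hσ1 : σ ≠ 1)
    (hT0 : ∀ x ∈ AddCommGroup.primaryComponent (↥(W.quadraticTwist (NumberField.discr K : ℚ)).sha) 2, x = 0)
    (hw : W.rootNumber = -1)
    (hline : ∀ x : (W.baseChange K).toAffine.Point,
      IsOfFinAddOrder (Affine.Point.map (W' := W) (σ : K →ₐ[ℚ] K) x - (-W.rootNumber) • x))
    {M : ℕ} {s : galH1Torsion (W.baseChange K) ((2 ^ M : ℕ) : ℤ)}
    (hs : s ∈ selmerGroup (W.baseChange K) ((2 ^ M : ℕ) : ℤ))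
    (hsν : conjAct W σ ((2 ^ M : ℕ) : ℤ) s = W.rootNumber • s) :
    (((2 : ℕ) : ℤ) ^ 2) • s = 0 := by
  by_contra hbig
  obtain ⟨-, -, hne, -⟩ := sha_class_of_selmerTrigger W hρ2 hIQ σ hline hs hsν (k := 1) hbig
  exact hne (by
    rw [pow_one]
    exact two_zsmul_torsionH1ToH1_eq_zero_of_selmer_eigen_of_twinShaTrivial W hIQ hσ1 hT0 hw hs hsν)

/-! ## §4 No prime-level trigger at any depth `M₀ ≥ 2`, on twin-`Ш`-trivial frames -/

/-- **THE PRIME-LEVEL ROAD IS CLOSED AT DEPTH `≥ 2` WHEN `Ш(E^{(d_K)}/ℚ)[2^∞] = 0`.**  Same frame as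
`four_zsmul_eq_zero_of_selmer_eigen_of_twinShaTrivial`; then **`2^{M₀}·s = 0` for every `M₀ ≥ 2`** and every
`s ∈ Sel_{2^M}(E/K)` with `σ_* s = w(E)·s` — i.e. the trigger `2^{M₀}·s ≠ 0` of file 1 §1
(`exists_kolyvaginHeegnerData_not_two_dvd_of_exactDepth_of_selmerTrigger_pow`) does not exist there.
[cite: Kramer1981, Thm. 1] [cite: GrossLMS1991, §5 (5.1), Prop. 5.3] [cite: McCallumLMS1991, §5 Prop. 5.2, Thm. 5.4] -/
theorem pow_zsmul_eq_zero_of_selmer_eigen_of_two_le_of_twinShaTrivial (hρ2 : W.HasSurjectiveModNGaloisRep 2)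
    (hIQ : IsImaginaryQuadratic K) {σ : K ≃ₐ[ℚ] K} (hσ1 : σ ≠ 1)
    (hT0 : ∀ x ∈ AddCommGroup.primaryComponent (↥(W.quadraticTwist (NumberField.discr K : ℚ)).sha) 2, x = 0)
    (hw : W.rootNumber = -1)
    (hline : ∀ x : (W.baseChange K).toAffine.Point,
      IsOfFinAddOrder (Affine.Point.map (W' := W) (σ : K →ₐ[ℚ] K) x - (-W.rootNumber) • x))
    {M : ℕ} {s : galH1Torsion (W.baseChange K) ((2 ^ M : ℕ) : ℤ)}
    (hs : s ∈ selmerGroup (W.baseChange K) ((2 ^ M : ℕ) : ℤ))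
    (hsν : conjAct W σ ((2 ^ M : ℕ) : ℤ) s = W.rootNumber • s) {M₀ : ℕ} (hM₀ : 2 ≤ M₀) :
    (((2 : ℕ) : ℤ) ^ M₀) • s = 0 := by
  obtain ⟨j, rfl⟩ := Nat.exists_eq_add_of_le hM₀
  rw [add_comm, pow_add, mul_smul,
    four_zsmul_eq_zero_of_selmer_eigen_of_twinShaTrivial W hρ2 hIQ hσ1 hT0 hw hline hs hsν]
  exact zsmul_zero _

/-! ## §5 The shape of the depth-one trigger, on twin-`Ш`-trivial frames -/

/-- **ON TWIN-`Ш`-TRIVIAL FRAMES THE DEPTH-ONE TRIGGER IS A SELMER SQUARE ROOT OF A NON-ZERO KUMMER CLASS.**  Same frame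
as `four_zsmul_eq_zero_of_selmer_eigen_of_twinShaTrivial`, `hdiv` naming the Kummer map at level `2^M`, and
`s ∈ Sel_{2^M}(E/K)` with `σ_* s = w(E)·s` and `2·s ≠ 0` (hand 9's F3 §4 trigger).  Then **`2·s ∈ δ(E(K))`, `2·s ≠ 0`,
`4·s = 0`**: file 1 §4's branch (B); branch (A) («`2·š ≠ 0` in `Ш(E/K)`») is excluded by §1.  In words: census item (β)
on such frames is the statement «the non-zero `2`-torsion Kummer class `δ(x)`, `x ∈ E(K) ∖ 2^M E(K)`, `2x ∈ 2^M E(K)`, is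
twice a `w(E)`-signed Selmer class» — a condition on `Sel_{2^M}(E/K)` and `E(K)` alone.
[cite: Kramer1981, Thm. 1, Prop. 3] [cite: GrossLMS1991, §5 (5.1), Prop. 5.3] [cite: SilvermanAEC2009, VIII.§2, Thm. X.4.2 (a)] -/
theorem selmerTrigger_shape_of_twinShaTrivial (hρ2 : W.HasSurjectiveModNGaloisRep 2)
    (hIQ : IsImaginaryQuadratic K) {σ : K ≃ₐ[ℚ] K} (hσ1 : σ ≠ 1)
    (hT0 : ∀ x ∈ AddCommGroup.primaryComponent (↥(W.quadraticTwist (NumberField.discr K : ℚ)).sha) 2, x = 0)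
    (hw : W.rootNumber = -1)
    (hline : ∀ x : (W.baseChange K).toAffine.Point,
      IsOfFinAddOrder (Affine.Point.map (W' := W) (σ : K →ₐ[ℚ] K) x - (-W.rootNumber) • x))
    {M : ℕ}
    (hdiv : ∀ P : geomPoints (W.baseChange K), ∃ Q : geomPoints (W.baseChange K), ((2 ^ M : ℕ) : ℤ) • Q = P)
    {s : galH1Torsion (W.baseChange K) ((2 ^ M : ℕ) : ℤ)}
    (hs : s ∈ selmerGroup (W.baseChange K) ((2 ^ M : ℕ) : ℤ))
    (hsν : conjAct W σ ((2 ^ M : ℕ) : ℤ) s = W.rootNumber • s) (h2s : ((2 : ℕ) : ℤ) • s ≠ 0) :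
    (2 : ℤ) • s ∈ (kummerMapTorsion (W.baseChange K) ((2 ^ M : ℕ) : ℤ) hdiv).range ∧
      (2 : ℤ) • s ≠ 0 ∧ (4 : ℤ) • s = 0 := by
  refine ⟨two_zsmul_mem_range_kummer_of_selmer_eigen_of_twinShaTrivial W hIQ hσ1 hT0 hw hdiv hs hsν,
    by exact_mod_cast h2s, ?_⟩
  have h4 := four_zsmul_eq_zero_of_selmer_eigen_of_twinShaTrivial W hρ2 hIQ hσ1 hT0 hw hline hs hsν
  norm_num at h4
  exact h4

end Summit.BirchSwinnertonDyer.BirchSwinnertonDyer.Theorems.CMKolyvaginFirstDescentTwoOnGivenFrame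

end
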